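import Mathlib
import HarnessLib
import HarnessLib.Audit
import Summits.MatrixMultiplication.Statement
import Literature.Computability.AlgebraicComplexity.MatrixMultiplicationExponent
import Literature.Computability.AlgebraicComplexity.AsymptoticSpectrum
import Literature.Computability.AlgebraicComplexity.CoppersmithWinograd1990Proofs
import Summits.MatrixMultiplication.MatrixMultiplication.Theorems.HessianPlaneCWPointAssembly
import HarnessLib.Audit.Status.Attr

/-!
Route: AsymptoticRankCW

X_B (Coppersmith–Winograd / Strassen asymptotic-rank instance): the asymptotic rank of the small
Coppersmith–Winograd
tensor T_cw,2 = Σ_{i=1}^{2} (e_0⊗e_i⊗e_i + e_i⊗e_0⊗e_i + e_i⊗e_i⊗e_0) ∈ ℂ^3⊗ℂ^3⊗ℂ^3 equals 3 (its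
flattening rank;
its border rank is 4): R~(T_cw,2) := lim_N R(T_cw,2^{⊗N})^{1/N} = 3, i.e. for every ε > 0,
R(T_cw,2^{⊗N}) = O(3^{(1+ε)N}).
By CoppersmithWinograd1990 (as in ConnerGesmundoLandsbergVentura2022 = arXiv:1909.04785 Thm 1.1 with
BCS Ex. 15.24;
Blaser2013 §9.2 p47: "If R~(CW) = q+1, then ω = 2 would follow (… for q = 2)"), ω ≤
log_q(4·R~(T_cw,q)^3/27), which for
q = 2, R~ = 3 gives ω ≤ log_2 4 = 2.

Lean (elaborates, Sketch.lean; the N-th Kronecker power is written inline, indexed by Fin N → Fin 3,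
so no new definition
is needed for the thesis itself):
∀ ε : ℝ, 0 < ε → (fun N : ℕ => (Literature.Computability.AlgebraicComplexity.tensorRank (K := ℂ)
(fun a b c : Fin N → Fin 3 => ∏ i, (if (a i = 0 ∧ b i = c i ∧ b i ≠ 0) ∨ (b i = 0 ∧ a i = c i ∧ a i
≠ 0) ∨ (c i = 0 ∧ a i = b i ∧ a i ≠ 0) then (1 : ℂ) else 0)) : ℝ)) =O[Filter.atTop] fun N : ℕ => (3
: ℝ) ^ ((1 + ε) * N)

Rationale: WHY THIS LINE. Mainstream tensor route, widened by the algebraic geometry of Kronecker powers.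
PROBLEMS.md §3 lists "Strassen's asymptotic rank conjecture → ω = 2"; the minimal instance that
already gives ω = 2 is the single tight 3×3×3 tensor T_cw,2 (Blaser2013 §9.2 p. 47, Problem 9.8;
CoppersmithWinograd1990 §6/§11; ConnerGesmundoLandsbergVentura2022 = arXiv:1909.04785 Thm 1.1 and p.
3; BurgisserClausenShokrollahi1997 Ex. 15.24(7)): X_B = "R~(T_cw,2) = 3" (growth form, target
BThesis). The step X_B → ω(ℂ) = 2 is NO LONGER an assumption: the Coppersmith–Winograd "easy"
laser-method bound in asymptotic-rank form is PROVED in tree (Literature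
…CoppersmithWinograd1990Proofs: CoppersmithWinograd1990_asymptoticRank_form_holds, a
restriction-only laser method — BCS Thm 15.39 hashing with a Salem–Spencer diagonal, Behrend —
giving ω(ℂ) ≤ log_q(4ρ³/27) from R(T_cw,q^{⊠N}) = O(ρ^{(1+ε)N})), so since rev 3 the DECIDING
THEOREM `closes (hX : BThesis) : MatrixMultiplication` is proved outright (q = 2, ρ = 3:
log₂(4·27/27) = 2, with omega_two_le ℂ). Unlike the big CW tensors, T_cw,2 is not hit by the
laser-method barriers (irreversibility / universal-method bounds evaluate to exactly 2 at q = 2;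
arXiv:1909.04785 p. 3). Imported from algebraic geometry: secant varieties, Koszul flattenings and
border apolarity for explicit Kronecker powers (CGLV Thm 1.2: 15 ≤ bR(T_cw,2^{⊠2}) ≤ 16, settled =
16 by ConnerHuangLandsberg2020 Thm 1.1; bR(T_cw,2^{⊠N}) ≥ 3^N + 2^N − 1), plus asymptotic-spectrum
obstructions (sibling route AsymptoticSpectrum: every known universal spectral point equals 3 at
T_cw,2, so no known obstruction to X_B exists).

RANKED CRUXES. #2 BRecordThreshold — R~(T_cw,2) ≤ 13/4 in the growth form of BThesis: necessary for
X_B and the exact way-point at which the q = 2 small CW tensor beats the ω record: by the proved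
CW90 fact ω(ℂ) ≤ log₂(4(13/4)³/27) = log₂(2197/432) = 2.3465 < 2.371339
(AlmanDuanVassilevskaWilliamsXuXuZhou2025; the record threshold sits at ρ = 3.2684); payoff filed as
support GlueRecordOmega (→ ω(ℂ) < 2.36). Why it might fail: R~(cw_2) may sit in (13/4, 3.931): the
only upper-bound technique known (AlmanLi2026 = arXiv:2605.21738 Thm 1.3 / §7.1 speed-ups) stalls
near 3.93. #3 BDet3AsymptoticRank — R~(det_3) = 9 (det_3 ≅ T_skewcw,2^{⊠2}, CGLV Lemma 2.4 proved in
tree); with the skew CW90 bound (CGLV Prop 2.2, NOT yet vendored; support GlueDet3Omega) it gives ω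
= 2 independently of X_B. Why it might fail: bR(T_skewcw,2) = 5 > 4 and only 9 ≤ R~(det_3) ≤
bR(det_3) = 17 is known (ConnerHarperLandsberg2019, ConnerHuangLandsberg2020). #4 BCubeBorderRank —
first strict submultiplicativity of BORDER rank at the cube, bR(T_cw,2^{⊠3}) ≤ 63 < 64 (topological
closure form; 45 ≤ bR known from the certified p = 2 Koszul rank, CGLV2022_thm12_holds.cube); finite
and certifiable by an explicit ℂ[ε]-family. Why it might fail: the square is multiplicative (= 16)
and cubes are multiplicative for every q > 4 (CGLV Thm 1.2; Kawabe arXiv:2507.13126), so q = 2 may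
follow suit. Target #0 BThesis (X_B itself, open since 1990: Blaser2013 Problem 9.8).

SUPPORT. Provable now from landed Literature (3-line proofs, candidate proofs attached as evidence
by the 2026-08-15 repair pass): OmegaGeTwo (admissibleExponents_bddBelow + omega_two_le), Assembly
(superseded as deciding theorem by `closes`, kept as the item recording the CW90 step:
matrixMultiplication_of_cw_two + CoppersmithWinograd1990_asymptoticRank_form_holds), BLowerFrame
(flatteningRank_kroneckerPow + flatteningRank_le_tensorRank), GlueRecordOmega (CW90 fact at ρ = 13/4
+ numerics logb 2 (2197/432) < 2.36). Genuine support work: BStrictSubmult (∃ k, R(T_cw,2^{⊠k}) <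
4^k — equivalent to R~ < 4, true by AlmanLi2026 Thm 1.3 but needs an explicit k or the speed-up
theorem vendored), GlueDet3Omega (needs the skew laser bound), BPerm3Form (X_B ↔ R~(perm_3) = 9 via
T_cw,2^{⊠2} ≅ perm_3, CGLV2022_lemma24, Fekete/limit form advxxz2025_asymptoticRank_tendsto,
flattening lower bound 9).

KILL CRITERIA. R~(T_cw,2) > 3 kills X_B and closes the route: e.g. a universal spectral point (or
any R~-monotone) F with F(T_cw,2) > 3, or ω(ℂ) > 2 (route BorderRankLowerBound; closes every
positive route). Partial kills: R~(T_cw,2) > 13/4 refutes #2 only (route survives on X_B but loses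
its record milestone); R~(det_3) > 9 (e.g. a spectral point > 3 at T_skewcw,2) refutes #3 only;
bR(T_cw,2^{⊠3}) = 64 (a new lower-bound technique beyond Koszul flattenings, which stop at 45)
refutes #4 only and pushes the first strict power to k ≥ 4.

NOT DECOMPOSED YET. How X_B itself would be proved beyond the way-points #2/#4: no finite exact
certificate for "= 3" exists (bR(T_cw,2^{⊠N}) ≥ 3^N + 2^N − 1 > 3^N for every N, and equal-format
catalytic degenerations T^{⊠(m+k)} ⊴ ⟨3^k⟩ ⊠ T^{⊠m} are impossible by orbit dimension — 2026-08-15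
repair census), so a proof of X_B needs a structural mechanism (tight-tensor asymptotic rank
conjecture at m = 3, BurgisserClausenShokrollahi1997 Problem 15.5) — left for a glued split once #2
or #4 closes. Also not decomposed: the skew CW90 laser bound for GlueDet3Omega (generalise
CoppersmithWinograd1990Proofs to the skew block values), values for q ≥ 3 (barred: irreversibility ≥
2.02), numerics of R(T_cw,2^{⊠3}) decomposition searches (flip-graph / ALS) — to be requested via
kit only after #4 is grounded.

CHEAPEST FALSIFIER. For the finite crux #4: a border-apolarity / higher Koszul-flattening
computation on T_cw,2^{⊠3} ∈ (ℂ^27)^{⊗3} certifying bR = 64 (one certified rank computation; CGLV's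
p = 2 Koszul map already gives 45). For the thesis X_B no cheap falsifier is known — every
catalogued spectral point gives exactly 3 at T_cw,2 (sibling route AsymptoticSpectrum) — so the
cheapest informative check is evaluating any NEW R~-monotone (e.g. the quantum functionals / a new
support-functional-type bound for non-free tensors) at T_cw,2 and at T_skewcw,2: a value > 3 at
T_cw,2 kills the route, > 3 at T_skewcw,2 kills #3.

Novelty: NOVELTY (retriage audit 2026-08-14; searched before claiming: `lit search --hybrid "Kronecker powers
small Coppersmith-Winograd tensor border rank asymptotic rank"`, `lit search "asymptotic rank
conjecture tight tensor"`, `lit frontier MatrixMultiplication --since 2021`, `lit read` of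
arXiv:2605.21738 §1/§7.1, arXiv:1811.05511 p.5, arXiv:2507.13126 §1, arXiv:2601.08119,
arXiv:2601.21553 p.1, plus the barrier catalogue).
Nearest prior art. (1) The thesis X_B is a problem posed verbatim in print: CoppersmithWinograd1990
§11; BurgisserClausenShokrollahi1997 Rem. 15.44 + Ex. 15.24(7) ("if we had R~(t^(2)) = 3, then we
could still conclude that omega = 2"); Blaser2013 Problem 9.8; ConnerGesmundoLandsbergVentura2022 §1
+ Question 3; arXiv:1811.05511 p.5 ("the m = 3 case"). Over C, T_cw,2 = 3*Sym(x0(x1^2+x2^2)) is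
isomorphic (x1^2+x2^2 = (x1+ix2)(x1-ix2); checked numerically) to (1/2)*Sum_{sigma in S_3}
e_sigma(0) (x) e_sigma(1) (x) e_sigma(2) = AlmanLi2026's cw_2', a TIGHT concise 3x3x3 tensor with Q~
= 3, so X_B is exactly the m = 3 instance of Strassen's asymptotic rank conjecture
(BurgisserClausenShokrollahi1997 Problem 15.5, p. 453; Strassen's tight form: §15.13 Notes p. 457).
(2) The Kronecker-power programme behind the cruxes is CGLV's: ConnerGesmundoLandsbergVentura2022
Thm. 1.2 (15 <= bR(T_cw,2^{x2}) <= 16; squares/cubes multiplicative for q > 2 / q > 4),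
ConnerHuangLandsberg2020 Thm. 1.1 (bR(T_cw,2^{x2}) = 16, square = perm_3: NO strict
submultiplicativity at k = 2), Kawab  [refs: 2605.21738, 1811.05511, 2507.13126, 2601.08119, 2601.21553, 2404.06427, 2009.11391, CoppersmithWinograd1990, BurgisserClausenShokrollahi1997, Blaser2013, ConnerGesmundoLandsbergVentura2022, AlmanLi2026, ConnerHuangLandsberg2020, ConnerHarperLandsberg2019, AlmanDuanVassilevskaWilliamsXuXuZhou2025]

Barriers (technique_class: fixed-intermediate-tensor,coppersmith-winograd,laser-method): BARRIERS (technique_class: fixed-intermediate-tensor,coppersmith-winograd,laser-method; catalogue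
Literature/Barriers/MatrixMultiplication read 2026-08-14).
- Literature.Barriers.MatrixMultiplication.IrreversibilityBarrier (ChristandlVranaZuiddam2021 Thm.
9/19; `CVZ2021_thm19.cw_barrier`): APPLIES to the Assembly's class (one fixed intermediate tensor t
= cw_2, asymptotic-rank bound composed with degenerations of powers to matrix products = the CW90
easy construction) but is numerically void at q = 2: the certified bound is >= 2 log2(3)/(log2 3 -
2/3 + 2/3) = 2 exactly (evasions_known (ii); CVZ Rem. 20). It bites iff i(cw_2) > 1 iff R~(cw_2) > 3
= Q~(cw_2), i.e. iff X_B is false: barrier and kill criterion coincide. For q >= 3 the same entry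
gives >= 2.02, which is why the thesis is pinned to q = 2.
- Literature.Barriers.MatrixMultiplication.UniversalMethodBarrier (Alman2021 Thm. 1.3, §4.2): same
verdict: omega_u lower bound = 2 at cw_2 (evasions_known (i): tensors with S~ = R~ unobstructed), >=
2.02538 for cw_q, q >= 3, and >= 2.16805 for every big CW_q: the route deliberately uses the small
tensor at q = 2 only.
- Literature.Barriers.MatrixMultiplication.UnstableTensorBarrier (BlaserLysikov2020 Thm. 16/17, Cor.
25): does NOT apply: cw_2 is semistable (evasions_known (ii), BL2020 §4) and not of minimal border
rank (bR = 4 > 3); the entry itself names "R~(cw_2) = 3 would prove omega = 2" as the open escape.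
- Literature.Barriers.MatrixMultiplication.RectangularBarrier (Christ

History (route lifecycle, newest last):
- 2026-08-16T04:10:30Z · AUTO-CRUX (backfill): BThesis — hypotheses of the deciding theorem that nothing in the route derives are cruxes (operator:999:1085951)

sub-problem: MatrixMultiplication · status: open · opened planner-MatrixMultiplication-Survey-0 2026-08-13T13:17:48Z · rev 5 · ledger route-MatrixMultiplication-AsymptoticRankCW
GENERATED by the gate from the ledger (D-0016/17). Provers cite these decls: `theorem foo : Summit.MatrixMultiplication.MatrixMultiplication.Theses.AsymptoticRankCW.<Decl> := …` in Summits/MatrixMultiplication/MatrixMultiplication/Theorems/<Name>.lean.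
-/

namespace Summit.MatrixMultiplication.MatrixMultiplication.Theses.AsymptoticRankCW

open scoped BigOperators Topology Manifold Classical MeasureTheory ProbabilityTheory Matrix InnerProductSpace ComplexConjugate ContinuousMap
open Filter Set Function TopologicalSpace MeasureTheory

attribute [summit_statement] _root_.MatrixMultiplication

/-- item stmt-MatrixMultiplication-0588 · crux (kind.auto-crux: conjecture-grade) · rank 0 · open · by planner
why it might fail: Open since CW90 (Blaser2013 Problem 9.8). Known only 3 <= R~(T_cw,2) < 3.931 (AlmanLi2026 Thm 1.3; speed-ups do not yet move omega, Rem 7.1); Kronecker square bR-multiplicative (=16, ConnerHuangLandsberg2020 Thm 1.1). '= 3' forces omega = 2: omega > 2 or a spectral point > 3 on T_cw,2 kills it.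
sources: Blaser2013, AlmanLi2026, arXiv:2605.21738, ConnerHuangLandsberg2020, ConnerGesmundoLandsbergVentura2022, BurgisserClausenShokrollahi1997
X_B: asymptotic rank of the small Coppersmith–Winograd tensor T_cw,2 (on Fin 3, e_0 distinguished)
is 3: for every ε>0, R(T_cw,2^{⊗N}) = O(3^{(1+ε)N}); Kronecker power written inline over Fin N → Fin
3 (Blaser2013 §9.2 Problem 9.8; arXiv:1909.04785 §1.2). -/
@[route_item "route-MatrixMultiplication-AsymptoticRankCW", crux]
def BThesis : Prop :=
  ∀ ε : ℝ, 0 < ε → (fun N : ℕ => (Literature.Computability.AlgebraicComplexity.tensorRank (K := ℂ) (fun a b c : Fin N → Fin 3 => ∏ i, (if (a i = 0 ∧ b i = c i ∧ b i ≠ 0) ∨ (b i = 0 ∧ a i = c i ∧ a i ≠ 0) ∨ (c i = 0 ∧ a i = b i ∧ a i ≠ 0) then (1 : ℂ) else 0)) : ℝ)) =O[Filter.atTop] fun N : ℕ => (3 : ℝ) ^ ((1 + ε) * N)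

/-- item stmt-MatrixMultiplication-1816 · crux · rank 2 · open · by planner
why it might fail: R~(cw_2) may lie in (13/4, 3.931): AlmanLi2026 speed-ups stall near 3.93 (worst spectral parameter θ = 2/3) and no other upper-bound technique is known; under SCC, card cw2-tripartition's D-down gives R~(cw_2) ≥ 3.31 > 13/4. A universal spectral point > 13/4 at cw_2 refutes it.
sources: AlmanLi2026, arXiv:2605.21738, ConnerGesmundoLandsbergVentura2022, AlmanDuanVassilevskaWilliamsXuXuZhou2025, arXiv:2311.02774, Blaser2013
[crux] Record threshold for the small Coppersmith–Winograd tensor: R~(T_cw,2) ≤ 13/4, in the growth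
form of BThesis (∀ε>0, R(T_cw,2^{⊗N}) = O((13/4)^{(1+ε)N}); same inline Kronecker power, rfl-equal
to kroneckerPow (cwTensor ℂ 2) N). NECESSARY for X_B (trivially implied by it) and the exact
way-point at which the q = 2 small CW tensor becomes the best matrix-multiplication algorithm known:
by the PROVED fact CoppersmithWinograd1990_asymptoticRank_form_holds (q := 2, ρ := 13/4), ω(ℂ) ≤
log_2(4(13/4)^3/27) = log_2(2197/432) = 2.3465 < 2.371339 = current record
(AlmanDuanVassilevskaWilliamsXuXuZhou2025); the threshold log_2(4ρ^3/27) = 2.371339 sits at ρ =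
3.2684 — payoff filed as support GlueRecordOmega. State of the art: 3 ≤ R~(cw_2) < 3.931
(AlmanLi2026 = arXiv:2605.21738 Thm 1.3 / Cor 7.1, via one-slice speed-ups cw_2^{⊗n} ⊕ ⟨1,t,1⟩ ⊴
⟨4^n⟩ ⊕ ⟨1,2^n,1⟩ + Strassen calculus; §7.1 p.17: iterating 'can be continued indefinitely' but the
gain is marginal; Rem 7.1: hybrid laser analyses still lose to CW90 on ω). Idea card
cw2-tripartition-scc-bridge (D-up: Pratt's balanced tripartition tensors T_k ≳ cw_2^{⊠κk},
arXiv:2311.02774) would give only 8^{1/κ} = 3.31, so 13/4 needs one further i -/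
@[route_item "route-MatrixMultiplication-AsymptoticRankCW"]
def BRecordThreshold : Prop :=
  ∀ ε : ℝ, 0 < ε → (fun N : ℕ => (Literature.Computability.AlgebraicComplexity.tensorRank (K := ℂ) (fun a b c : Fin N → Fin 3 => ∏ i, (if (a i = 0 ∧ b i = c i ∧ b i ≠ 0) ∨ (b i = 0 ∧ a i = c i ∧ a i ≠ 0) ∨ (c i = 0 ∧ a i = b i ∧ a i ≠ 0) then (1 : ℂ) else 0)) : ℝ)) =O[Filter.atTop] fun N : ℕ => ((13 : ℝ) / 4) ^ ((1 + ε) * N)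

/-- item stmt-MatrixMultiplication-0591 · crux · rank 3 · open · by planner
why it might fail: R~(det_3) = R~(T_skewcw,2)^2, bR(T_skewcw,2) = 5 > 4 = bR(T_cw,2) (ConnerHuangLandsberg2020 Thm 1.2); only 9 <= R~(det_3) <= bR(det_3) = 17 known (ConnerHarperLandsberg2019 Thm 1.2; CGLV Thm 1.3); '= 9' forces omega = 2 (CGLV Prop 2.2): omega > 2 refutes it; no speed-up bound (AlmanLi2026) known.
sources: ConnerGesmundoLandsbergVentura2022, arXiv:1909.04785, ConnerHarperLandsberg2019, arXiv:1911.07981, ConnerHuangLandsberg2020, AlmanLi2026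
Skew sibling (arXiv:1909.04785 Prop 2.2 and §1): the asymptotic rank of the 3×3 determinant tensor
det_3 ∈ ℂ^9⊗ℂ^9⊗ℂ^9 (entry sgn-product ε_{a1 b1 c1} ε_{a2 b2 c2} at ((a1,a2),(b1,b2),(c1,c2)))
equals its flattening rank 9; since det_3 = T_skewcw,2^{⊠2} up to change of basis and the CW90 bound
holds for T_skewcw,q, R~(det_3) = 9 ⇒ R~(T_skewcw,2) = 3 ⇒ ω = 2. Needs
kroneckerTensor/asymptoticRank definitions; det_3 tensor can be inlined via Equiv.Perm.sign once
wanted. -/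
@[route_item "route-MatrixMultiplication-AsymptoticRankCW", crux]
def BDet3AsymptoticRank : Prop :=
  Literature.Computability.AlgebraicComplexity.asymptoticRank (Literature.Computability.AlgebraicComplexity.kroneckerTensor (fun a b c : Fin 3 => (if b = a + 1 ∧ c = a + 2 then (1 : ℂ) else 0) - (if b = a + 2 ∧ c = a + 1 then 1 else 0)) (fun a b c : Fin 3 => (if b = a + 1 ∧ c = a + 2 then (1 : ℂ) else 0) - (if b = a + 2 ∧ c = a + 1 then 1 else 0))) = 9

/-- item stmt-MatrixMultiplication-1852 · crux · rank 4 · open · by planner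
why it might fail: bR(cw_2^{⊠2}) = 16 is multiplicative (ConnerHuangLandsberg2020) and CGLV prove cube multiplicativity for all q > 4; q = 2 may follow suit (bR = 64), moving the first strict power to k ≥ 4. Refuting needs lower bounds beyond Koszul flattenings (they stop at 45).
sources: ConnerGesmundoLandsbergVentura2022, arXiv:1909.04785, ConnerHuangLandsberg2020, arXiv:2009.11391, arXiv:2507.13126, AlmanLi2026
[crux] First strict submultiplicativity of BORDER rank for the small CW tensor, at the cube:
bR(T_cw,2^{⊠3}) ≤ 63 < 64 = bR(T_cw,2)^3. Stated topologically — T_cw,2^{⊠3} = kroneckerPow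
(cwTensor-inline) 3 ∈ (ℂ^27)^{⊗3}, written on (Fin 3 → Fin 3)^3, lies in the Euclidean closure of
the tensors of rank ≤ 63 — because the route file imports only
MatrixMultiplicationExponent/AsymptoticSpectrum (no algBorderRank/cwTensor; the inline tensor is
rfl-equal to cwTensor ℂ 2). Over ℂ this is equivalent to algBorderRank ≤ 63 (SchoenhageTau.lean):
ℂ[ε]-families give limits, and secant varieties have equal Zariski/Euclidean closures;
Koszul-flattening lower bounds transfer directly by lower semicontinuity of matrix rank. Known: 45 =
15·3 ≤ bR (ConnerGesmundoLandsbergVentura2022 = arXiv:1909.04785 Thm 1.2, q = 2 cube clause, PROVED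
in tree as CGLV2022_thm12_holds.cube from the certified p = 2 Koszul rank 265) and bR ≤ 4^3 = 64;
the square is multiplicative, bR(T_cw,2^{⊠2}) = bR(perm_3) = 16 (ConnerHuangLandsberg2020 =
arXiv:2009.11391 Thm 1.1, 'bad news'); cubes ARE multiplicative for every q > 4 (CGLV Thm 1.2;
Kawabe arXiv:2507.13126 Thm 4.1 reproves q ≥ 5), nothing beyond the Koszul bounds is k -/
@[route_item "route-MatrixMultiplication-AsymptoticRankCW"]
def BCubeBorderRank : Prop :=
  Literature.Computability.AlgebraicComplexity.kroneckerPow (fun i j k : Fin 3 => if (i = 0 ∧ j = k ∧ j ≠ 0) ∨ (j = 0 ∧ i = k ∧ i ≠ 0) ∨ (k = 0 ∧ i = j ∧ i ≠ 0) then (1 : ℂ) else 0) 3 ∈ closure {s : (Fin 3 → Fin 3) → (Fin 3 → Fin 3) → (Fin 3 → Fin 3) → ℂ | Literature.Computability.AlgebraicComplexity.tensorRank s ≤ 63}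

/-- item stmt-MatrixMultiplication-18009 · crux · rank 5 · open · by planner
why it might fail: A dark spectral point may order the two special (polystable) points of the torus pencil the other way, F(cw_2) > F(ε): all known points tie at 3, honest degeneration ε ⊵ xyz is GIT-forbidden, only asymptotic/catalytic degenerations can prove it; finite proxy against: bR(ε^⊠3) < 45 ≤ bR(cw_2^⊠3).
sources: ConnerGesmundoLandsbergVentura2022, arXiv:1909.04785, ConnerHuangLandsberg2020, arXiv:2009.11391, ChristandlVranaZuiddam2023, arXiv:2404.06427
[crux] (crux-strategist split of BThesis through the route own rank-3 crux, 2026-08-17; glue PROVED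
sorry-free: Cruxes/BThesis/Lines/skew_anchor_split.lean, theorem bThesis_of_skew_subs :
BDet3AsymptoticRank → BSkewDominatesCw → BThesis) THE SKEW SIBLING DOMINATES THE SMALL CW TENSOR
ASYMPTOTICALLY: R~(T_cw,2) ≤ R~(ε), ε the Levi-Civita tensor on Fin 3 inlined exactly as in
BDet3AsymptoticRank (≅ T_skewcw,2; ε⊠ε ≅ det_3, CGLV2022 Lemma 2.4), T_cw,2 inlined as in BThesis
(rfl-equal to cwTensor ℂ 2). NECESSARY for BThesis (R~(ε) ≥ 3 by flattening) and, jointly with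
BDet3AsymptoticRank (R~(det_3) = 9 ⇒ R~(ε) = 3), SUFFICIENT: it turns every advance on crux 3 into
an advance on crux 0. Fixes no value; consistent with ω > 2; NOT summit-strength. Intended
mechanism: an asymptotic degeneration ε^{⊠(N+o(N))} ⊵ T_cw,2^{⊠N} (equivalently F(T_cw,2) ≤ F(ε) for
every universal spectral point, by the proved Strassen duality); an HONEST degeneration ε ⊵ xyz is
impossible (both are polystable points of the Cartan subspace of ℂ³⊗ℂ³⊗ℂ³, closed SL₃³-orbits of one
format never degenerate properly into each other), so the content is genuinely asymptotic/catalytic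
(first candidates: det_3^{⊠m} ⊵ perm_3^ -/
@[route_item "route-MatrixMultiplication-AsymptoticRankCW", crux]
def BSkewDominatesCw : Prop :=
  Literature.Computability.AlgebraicComplexity.asymptoticRank (fun i j k : Fin 3 => if (i = 0 ∧ j = k ∧ j ≠ 0) ∨ (j = 0 ∧ i = k ∧ i ≠ 0) ∨ (k = 0 ∧ i = j ∧ i ≠ 0) then (1 : ℂ) else 0) ≤ Literature.Computability.AlgebraicComplexity.asymptoticRank (fun a b c : Fin 3 => (if b = a + 1 ∧ c = a + 2 then (1 : ℂ) else 0) - (if b = a + 2 ∧ c = a + 1 then 1 else 0))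

/-- item stmt-MatrixMultiplication-0590 · support · rank 2 · closed · proved by Summit.MatrixMultiplication.MatrixMultiplication.Theorems.bStrictSubmult_proof @ d0c8d461ed3e (prover) · by planner
sources: AlmanLi2026, arXiv:2605.21738, ConnerHuangLandsberg2020, ConnerGesmundoLandsbergVentura2022
First strict submultiplicativity of T_cw,2 under Kronecker powers: ∃ k ≥ 1 with R(T_cw,2^{⊠k}) < 4^k
(rank version; certifiable by an explicit decomposition). Informal companion (needs borderRank): is
bR(T_cw,2^{⊠2}) = 15 (arXiv:1909.04785 Thm 1.2 leaves 15 ≤ bR ≤ 16)? Equivalent to R~(T_cw,2) < 4 by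
Fekete; necessary for X_B. -/
@[route_item "route-MatrixMultiplication-AsymptoticRankCW"]
def BStrictSubmult : Prop :=
  ∃ k : ℕ, 0 < k ∧ Literature.Computability.AlgebraicComplexity.tensorRank (K := ℂ) (fun a b c : Fin k → Fin 3 => ∏ i, (if (a i = 0 ∧ b i = c i ∧ b i ≠ 0) ∨ (b i = 0 ∧ a i = c i ∧ a i ≠ 0) ∨ (c i = 0 ∧ a i = b i ∧ a i ≠ 0) then (1 : ℂ) else 0)) < 4 ^ k

/-- item stmt-MatrixMultiplication-0592 · support · rank 4 · closed · proved by Summit.MatrixMultiplication.MatrixMultiplication.Theorems.bLowerFrame_proof @ 045c7b513df3 (prover) · by planner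
sources: ConnerGesmundoLandsbergVentura2022, BurgisserClausenShokrollahi1997
Lower frame for X_B: 3^N ≤ R(T_cw,2^{⊗N}) for every N (the first flattening of T_cw,2 has rank 3 and
flattening rank is multiplicative under Kronecker powers; elementary half of arXiv:1909.04785 Thm
1.2, which even gives border rank ≥ 3^N + 2^N − 1). -/
@[route_item "route-MatrixMultiplication-AsymptoticRankCW"]
def BLowerFrame : Prop :=
  ∀ N : ℕ, 3 ^ N ≤ Literature.Computability.AlgebraicComplexity.tensorRank (K := ℂ) (fun a b c : Fin N → Fin 3 => ∏ i, (if (a i = 0 ∧ b i = c i ∧ b i ≠ 0) ∨ (b i = 0 ∧ a i = c i ∧ a i ≠ 0) ∨ (c i = 0 ∧ a i = b i ∧ a i ≠ 0) then (1 : ℂ) else 0))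

/-- item stmt-MatrixMultiplication-0586 · support · rank 5 · closed · proved by Summit.MatrixMultiplication.MatrixMultiplication.Theorems.omegaGeTwo_proof @ cbdcc04c67d9 (prover) · by planner
Lower frame shared by all positive routes: admissibleExponents ℂ is bounded below and 2 ≤ ω(ℂ), from
the flattening bound R(<n,n,n>) ≥ n^2 (Blaser2013 §5–6; BurgisserClausenShokrollahi1997 (15.?)
conciseness) and n^2 = O(n^β) ⇒ β ≥ 2. -/
@[route_item "route-MatrixMultiplication-AsymptoticRankCW"]
def OmegaGeTwo : Prop :=
  BddBelow (Literature.Computability.AlgebraicComplexity.admissibleExponents ℂ) ∧ 2 ≤ Literature.Computability.AlgebraicComplexity.omega ℂ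

/-- item stmt-MatrixMultiplication-1886 · support · rank 9 · closed · proved by Summit.MatrixMultiplication.MatrixMultiplication.Theorems.glueRecordOmega_proof @ 8b6f2bc0f9d9 (prover) · by planner
[support] Payoff glue for the rank-2 crux BRecordThreshold: the PROVED fact
`CoppersmithWinograd1990_asymptoticRank_form_holds 2 le_rfl (13/4) _ hX`
(CoppersmithWinograd1990Proofs.lean; ConnerGesmundoLandsbergVentura2022 Thm 1.1 / p. 3 =
BurgisserClausenShokrollahi1997 Ex. 15.24) gives ω(ℂ) ≤ Real.logb 2 (4·(13/4)^3/27) = logb 2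
(2197/432) = 2.3465…; remaining numerics 2197/432 < 2^{2.36} as in
CwEasyOmegaBound.cw_easy_numerics. Planner sketch (Sketch.lean, rc 0) reduces the item to `Real.logb
2 (2197/432) < 2.36`. Documents in Lean that the milestone beats the ω record 2.371339
(AlmanDuanVassilevskaWilliamsXuXuZhou2025) through a 1990 construction. -/
@[route_item "route-MatrixMultiplication-AsymptoticRankCW"]
def GlueRecordOmega : Prop :=
  BRecordThreshold → Literature.Computability.AlgebraicComplexity.omega ℂ < 2.36

/-- item stmt-MatrixMultiplication-1889 · support · rank 9 · closed · proved by Summit.MatrixMultiplication.MatrixMultiplication.Theorems.glueDet3Omega_proof (prover) · by planner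
[support] Glue making the rank-3 crux BDet3AsymptoticRank close the summit: R~(det_3) = 9 ⇒
R~(T_skewcw,2) = 3 (the crux's tensor is T_skewcw,2 ⊠ T_skewcw,2 ≅ det_3: CGLV2022_lemma24, PROVED
in tree; R~(t ⊠ t) = R~(t)^2 from the limit form advxxz2025_asymptoticRank_tendsto / Fekete) ⇒ ω(ℂ)
≤ log_2(4·3^3/27) = 2 by the skew version of the CW90 easy bound (ConnerGesmundoLandsbergVentura2022
Prop. 2.2: 'Theorem 1.1 holds for T_skewcw,q'; the laser analysis of CoppersmithWinograd1990Proofs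
goes through verbatim — same coarse block support {(0,j,j),(j,0,j),(j,j,0)}, the (·,·,0) block being
a nondegenerate skew form ≅ ⟨1,q,1⟩ after a change of basis in one factor), then omega_two_le for
equality. Without this glue the rank-3 crux sits outside the frame item's chain (BThesis → summit).
The skew laser bound is NOT yet in Literature: a prover either generalises
CoppersmithWinograd1990Proofs to skewCwTensor ℂ 1 (or to any tensor with this block structure and
block values) or exits `blocked: upstream: needs CGLV2022 Prop 2.2 (skew CW90 bound)`. Sources:
ConnerGesmundoLandsbergVentura2022 Prop 2.2, Lemma 2.4; ConnerHuangLandsberg2020 (bR(det_3) = 17 <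
25); CoppersmithWinograd1990 §6. -/
@[route_item "route-MatrixMultiplication-AsymptoticRankCW"]
def GlueDet3Omega : Prop :=
  BDet3AsymptoticRank → MatrixMultiplication

/-- item stmt-MatrixMultiplication-1900 · support · rank 9 · closed · proved by Summit.MatrixMultiplication.MatrixMultiplication.Theorems.bPerm3Form_proof @ eeba7a06571e (prover) · by planner
[support] The permanent form of the thesis: X_B ↔ R~(perm_3) = 9, with perm_3 ∈ ℂ^9⊗ℂ^9⊗ℂ^9 inlined
as (1/6)·[a₁,b₁,c₁ pairwise distinct]·[a₂,b₂,c₂ pairwise distinct] on (Fin 3 × Fin 3)^3 —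
extensionally equal to perm3Tensor of BorderRankCW.lean ((1/6)|ε_{a₁b₁c₁}||ε_{a₂b₂c₂}|), which the
route file cannot import. Ingredients, all PROVED in tree: T_cw,2^{⊠2} ≅ perm_3 (CGLV2022_lemma24),
GL^3-invariance of tensorRank/asymptoticRank, R~(t^{⊠2}) = R~(t)^2 and growth form ↔ iInf form
(advxxz2025_asymptoticRank_tendsto, Fekete), and the lower bound 9 = flattening rank ≤ R~(perm_3)
(gaugePoint_isUniversalSpectralPoint_holds + strassen_duality_asymptoticRank_holds, or
flatteningRank_kroneckerPow + flatteningRank_le_tensorRank). Reading: X_B says the asymptotic rank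
of the 3×3 permanent tensor is its flattening rank 9, against bR(perm_3) = 16 = Glynn's 4^{n-1}
count (ConnerHuangLandsberg2020 Thm 1.1); re-bases Blaser2013 Problem 9.8 on the permanent/Waring
literature (Glynn 2010, Ilten–Teitler 2016, CHL2020 = arXiv:2009.11391). Sources:
ConnerGesmundoLandsbergVentura2022 Lemma 2.4; ConnerHuangLandsberg2020. -/
@[route_item "route-MatrixMultiplication-AsymptoticRankCW"]
def BPerm3Form : Prop :=
  BThesis ↔ Literature.Computability.AlgebraicComplexity.asymptoticRank (fun a b c : Fin 3 × Fin 3 => if (a.1 ≠ b.1 ∧ b.1 ≠ c.1 ∧ a.1 ≠ c.1 ∧ a.2 ≠ b.2 ∧ b.2 ≠ c.2 ∧ a.2 ≠ c.2) then (1 / 6 : ℂ) else 0) = 9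

/-- item stmt-MatrixMultiplication-0589 · assembly · rank 1 · closed · proved by Summit.MatrixMultiplication.MatrixMultiplication.Theorems.cwPointAssembly_proof @ 373a1da5ead4 (prover) · by planner
X_B → ω(ℂ) = 2: Coppersmith–Winograd 1990 easy construction via the laser method with asymptotic
rank in place of border rank: ω ≤ log_q(4·R~(T_cw,q)^3/27), q = 2 (Blaser2013 §9.2 p46–47;
ConnerGesmundoLandsbergVentura2022 = arXiv:1909.04785 Thm 1.1 + BCS Ex. 15.24). Substantial
Literature theorem (τ-theorem Blaser2013 Thm 7.5, Thm 9.6); expect re-filing as (h : Fact) → …. -/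
@[route_item "route-MatrixMultiplication-AsymptoticRankCW"]
def Assembly : Prop :=
  (∀ ε : ℝ, 0 < ε → (fun N : ℕ => (Literature.Computability.AlgebraicComplexity.tensorRank (K := ℂ) (fun a b c : Fin N → Fin 3 => ∏ i, (if (a i = 0 ∧ b i = c i ∧ b i ≠ 0) ∨ (b i = 0 ∧ a i = c i ∧ a i ≠ 0) ∨ (c i = 0 ∧ a i = b i ∧ a i ≠ 0) then (1 : ℂ) else 0)) : ℝ)) =O[Filter.atTop] fun N : ℕ => (3 : ℝ) ^ ((1 + ε) * N)) → MatrixMultiplication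

/-- `Assembly` holds: proved by `Summit.MatrixMultiplication.MatrixMultiplication.Theorems.cwPointAssembly_proof` @ 373a1da5ead4. -/
theorem Assembly_holds : Assembly := _root_.Summit.MatrixMultiplication.MatrixMultiplication.Theorems.cwPointAssembly_proof

/-! D-0027 §2.1 — DECIDING THEOREM (planner-authored via `route open/edit --closes-file`; by planner-rbadge-MatrixMultiplication-Asymptotic-4ca3315b-g2-0 2026-08-15T16:14:47Z):
its hypotheses are this route's items and its conclusion the sub-problem Statement (glue_lint), and it elaborates with this file. -/

/-- DECIDING THEOREM (D-0027 §2.1): the target `BThesis` (X_B: `R~(T_cw,2) = 3` in growth form)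
ALONE decides `ω(ℂ) = 2`, through PROVED Literature only — no other item is assumed.
The Coppersmith–Winograd 1990 "easy" laser-method bound in asymptotic-rank form,
`CoppersmithWinograd1990_asymptoticRank_form_holds` (CoppersmithWinograd1990Proofs.lean: restriction-only
laser method, BCS Thm 15.39 hashing with a Salem–Spencer diagonal + Behrend; = CGLV 2022 Thm 1.1 with
p. 3 / BCS97 Ex. 15.24(7) / Bläser 2013 §9.2 p. 47), specialised to `q = 2, ρ = 3`, gives
`ω(ℂ) ≤ log₂(4·3³/27) = 2` (`omega_le_two_of_cw_two`); the flattening lower frame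
`omega_two_le ℂ : 2 ≤ ω(ℂ)` (FlatteningBound.lean) closes (`matrixMultiplication_of_cw_two`). -/
@[closes "route-MatrixMultiplication-AsymptoticRankCW"] theorem closes (hX : BThesis) : MatrixMultiplication :=
  Literature.Computability.AlgebraicComplexity.matrixMultiplication_of_cw_two
    Literature.Computability.AlgebraicComplexity.CoppersmithWinograd1990_asymptoticRank_form_holds
    (Literature.Computability.AlgebraicComplexity.omega_two_le ℂ) hX

end Summit.MatrixMultiplication.MatrixMultiplication.Theses.AsymptoticRankCW
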